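import Literature.GroupTheory.ProP.ProPFiniteIndexOpen
import Mathlib.Topology.Algebra.OpenSubgroup
import HarnessLib

/-!
# Finite-index subgroups of a product of topologically finitely generated pro-`p` groups over DISTINCT
# primes are open (Serre's theorem ⇒ the pronilpotent case of Nikolov–Segal)

N. Nikolov, D. Segal, *On finitely generated profinite groups I*, Ann. of Math. **165** (2007), Thm. 1.1 [cite: NikolovSegal2003, Thm 1.1]
("in a topologically finitely generated profinite group every subgroup of finite index is open"); J. D.
Dixon, M. P. F. du Sautoy, A. Mann, D. Segal, *Analytic pro-`p` groups* (2nd ed.), Ch. 1, Thm. 1.17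
(Serre: the pro-`p` case) [cite: DixonDuSautoyMannSegal1999, Ch. 1 Thm. 1.17].

This proof-only file (abc-iut cell, seat abc-iut-w5-d095 gen 4; classical, Mathlib + the tree's pro-`p`
files of abc-iut-w5-d200 / abc-iut-w5-d218) extends Serre's theorem `ProP.isOpen_of_finiteIndex` from ONE
pro-`p` group to arbitrary PRODUCTS `Π i, P i` of topologically finitely generated pro-`pᵢ` groups over
pairwise DISTINCT primes `pᵢ` — i.e. to the pronilpotent profinite groups with topologically finitely
generated Sylow subgroups (a pronilpotent profinite group is the product of its Sylow pro-`p` subgroups;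
that structure theorem is not needed here since we work with the product directly).  Note that the
product itself need NOT be topologically finitely generated (the number of generators of `P i` may be
unbounded in `i`), so the statement is not literally contained in Nikolov–Segal's.

Proof (`isOpen_of_finiteIndex_pi`).  Pass to the normal core `N`, of finite index `n`; then `g ^ n ∈ N`
for every `g`.  (1) Off the finitely many indices `i` with `pᵢ ∣ n`, the `n`-th power map of `P i` is
SURJECTIVE (`pow_surjective_of_proP`, `pᵢ` coprime to `n`), hence so is that of the sub-product
`Π_{pᵢ ∤ n} P i`; so this whole sub-product consists of `n`-th powers and lies in `N` — no closedness of
`N` is needed.  (2) At each of the finitely many `i` with `pᵢ ∣ n`, the pull-back of `N` to `P i` has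
finite index, hence is OPEN by Serre's theorem.  (3) The set of `g` whose coordinates at those finitely
many `i` lie in the pull-backs is an open neighbourhood of `1` contained in `N` (split `g` into its
finitely supported part, a finite product of elements of `N`, and the rest, an `n`-th power); a subgroup
containing a neighbourhood of `1` is open.

Relation to the abc-iut FACT-LIST: row F-1977 `Rmk253.FiniteIndexOpenOfTopFG` ([IUTchI] Rmk 2.5.3 (vi)
(O3), the full Nikolov–Segal statement) stays a named fact; this file enlarges the PROVED instance class
from pro-`p` (w5-d200/w5-d218) to products of pro-`pᵢ` over distinct primes.  Classical; no bearing on,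
and no side taken on, [IUTchIII] Cor. 3.12.
-/

namespace Literature.GroupTheory.ProP

open Subgroup Topology

universe u v

section PiProduct

/-- The pull-back of a finite-index subgroup along a homomorphism has finite index. [folklore] -/
private theorem finiteIndex_comap {G : Type*} {G' : Type*} [Group G] [Group G'] (f : G' →* G) (N : Subgroup G)
    [N.FiniteIndex] : (N.comap f).FiniteIndex :=
  ⟨by
    rw [Subgroup.index_comap]
    exact fun h => Subgroup.FiniteIndex.index_ne_zero (Subgroup.index_eq_zero_of_relIndex_eq_zero h)⟩

variable {ι : Type u} {P : ι → Type v} [∀ i, Group (P i)] [∀ i, TopologicalSpace (P i)]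
  [∀ i, IsTopologicalGroup (P i)] [∀ i, CompactSpace (P i)] [∀ i, TotallyDisconnectedSpace (P i)]

/-- **Finite-index subgroups of a product of topologically finitely generated pro-`pᵢ` groups over
pairwise distinct primes `pᵢ` are open** (the pronilpotent case of the Nikolov–Segal theorem, from
Serre's pro-`p` theorem). Hypotheses per factor: `P i` profinite (compact, totally disconnected
topological group), pro-`p i` (`hP`: continuous finite quotients are `p i`-groups), topologically
finitely generated (`htfg`); `p` injective. [cite: DixonDuSautoyMannSegal1999, Ch. 1 Thm. 1.17] -/
theorem isOpen_of_finiteIndex_pi (p : ι → ℕ) (hp : ∀ i, (p i).Prime) (hinj : Function.Injective p)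
    (hP : ∀ i, ∀ U : OpenNormalSubgroup (P i), IsPGroup (p i) (P i ⧸ (U : Subgroup (P i))))
    (htfg : ∀ i, ∃ (d : ℕ) (a : Fin d → P i), (Subgroup.closure (Set.range a)).topologicalClosure = ⊤)
    (H : Subgroup (∀ i, P i)) [H.FiniteIndex] : IsOpen (H : Set (∀ i, P i)) := by
  classical
  -- pass to the normal core `N`, of finite index `n`
  let N := H.normalCore
  haveI : N.Normal := Subgroup.normalCore_normal H
  haveI : N.FiniteIndex := inferInstance
  refine Subgroup.isOpen_mono (Subgroup.normalCore_le H) ?_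
  set n := N.index with hn
  have hn0 : n ≠ 0 := Subgroup.FiniteIndex.index_ne_zero
  have hpow : ∀ g : ∀ i, P i, g ^ n ∈ N := fun g => Subgroup.pow_index_mem N g
  -- the finitely many indices whose prime divides `n`
  let T : Set ι := p ⁻¹' (n.primeFactors : Set ℕ)
  have hT : T.Finite := Set.Finite.preimage (hinj.injOn) (Finset.finite_toSet _)
  have hmemT : ∀ i, i ∈ T ↔ p i ∣ n := fun i => by
    simp only [T, Set.mem_preimage, Finset.mem_coe, Nat.mem_primeFactors]
    exact ⟨fun h => h.2.1, fun h => ⟨hp i, h, hn0⟩⟩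
  -- (2) at `i ∈ T`, the pull-back of `N` to `P i` is open (Serre)
  let φ : ∀ i, P i →* ∀ i, P i := fun i => MonoidHom.mulSingle P i
  have hNi : ∀ i, IsOpen ((N.comap (φ i) : Subgroup (P i)) : Set (P i)) := by
    intro i
    haveI : Fact (p i).Prime := ⟨hp i⟩
    haveI : (N.comap (φ i)).FiniteIndex := finiteIndex_comap (φ i) N
    obtain ⟨d, a, ha⟩ := htfg i
    exact isOpen_of_finiteIndex (hP i) ha _
  -- (3) the open neighbourhood of `1`
  let U : Set (∀ i, P i) := ⋂ i ∈ T, (fun g : ∀ i, P i => g i) ⁻¹' (N.comap (φ i) : Set (P i))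
  have hUo : IsOpen U := hT.isOpen_biInter fun i _ => (hNi i).preimage (continuous_apply i)
  have h1U : (1 : ∀ i, P i) ∈ U := by
    simp only [U, Set.mem_iInter, Set.mem_preimage, SetLike.mem_coe]
    intro i _
    exact Subgroup.one_mem _
  -- (1)+(3): `U ⊆ N`
  have hUN : U ⊆ (N : Set (∀ i, P i)) := by
    intro g hg
    simp only [U, Set.mem_iInter, Set.mem_preimage, SetLike.mem_coe, Subgroup.mem_comap] at hg
    -- split `g` into its `T`-part and its off-`T` part
    let gT : ∀ i, P i := fun i => if i ∈ T then g i else 1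
    let gT' : ∀ i, P i := fun i => if i ∈ T then 1 else g i
    have hsplit : g = gT * gT' := by
      funext i
      by_cases hi : i ∈ T <;> simp [gT, gT', hi]
    -- the `T`-part: a finite product of elements of `N`
    have hgT : gT ∈ N := by
      -- by induction over finite subsets of `T`
      suffices key : ∀ s : Finset ι, (↑s : Set ι) ⊆ T →
          (fun i => if i ∈ s then g i else 1 : ∀ i, P i) ∈ N by
        have := key hT.toFinset (by simp)
        have heq : (fun i => if i ∈ hT.toFinset then g i else 1 : ∀ i, P i) = gT := by
          funext i; simp [gT, Set.Finite.mem_toFinset]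
        rw [heq] at this
        exact this
      intro s
      induction s using Finset.induction_on with
      | empty =>
        intro _
        have h1 : (fun i => if i ∈ (∅ : Finset ι) then g i else 1 : ∀ i, P i) = 1 := by
          funext i; simp
        rw [h1]
        exact N.one_mem
      | insert a s ha ih =>
        intro hs
        have haT : a ∈ T := hs (by simp)
        have hsT : (↑s : Set ι) ⊆ T := fun i hi => hs (by simp [Finset.mem_coe.mp hi])
        have hmul : (fun i => if i ∈ insert a s then g i else 1 : ∀ i, P i) =
            φ a (g a) * fun i => if i ∈ s then g i else 1 := by
          funext i
          by_cases hia : i = a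
          · subst hia
            simp [φ, ha]
          · simp [φ, hia, Pi.mulSingle, Function.update, Finset.mem_insert]
        rw [hmul]
        exact N.mul_mem (hg a haT) (ih hsT)
    -- the off-`T` part: an `n`-th power
    have hgT' : gT' ∈ N := by
      have hsurj : ∀ i, i ∉ T → Function.Surjective fun x : P i => x ^ n := by
        intro i hi
        have hcop : (p i).Coprime n := (Nat.Prime.coprime_iff_not_dvd (hp i)).mpr ((hmemT i).not.mp hi)
        exact Literature.GroupTheory.pow_surjective_of_proP (hP i) hcop
      choose y hy using fun i : {i // i ∉ T} => hsurj i.1 i.2 (g i.1)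
      let y' : ∀ i, P i := fun i => if hi : i ∈ T then 1 else y ⟨i, hi⟩
      have hy' : y' ^ n = gT' := by
        funext i
        by_cases hi : i ∈ T
        · simp [y', gT', hi]
        · have := hy ⟨i, hi⟩
          simp only [Pi.pow_apply, y', gT', hi, dite_false, if_false]
          simpa using this
      rw [← hy']
      exact hpow y'
    rw [hsplit]
    exact N.mul_mem hgT hgT'
  exact Subgroup.isOpen_of_mem_nhds N (Filter.mem_of_superset (hUo.mem_nhds h1U) hUN)

/-- The two-factor case: for DISTINCT primes `p ≠ q`, a topologically finitely generated pro-`p` group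
`A` and pro-`q` group `B`, every finite-index subgroup of `A × B`... stated over the product of a
`Bool`-indexed family to reuse `isOpen_of_finiteIndex_pi` (corollary form for consumers that index
Sylow factors by primes). [cite: DixonDuSautoyMannSegal1999, Ch. 1 Thm. 1.17] -/
theorem isOpen_of_finiteIndex_pi_primes {P : Nat.Primes → Type v} [∀ q, Group (P q)]
    [∀ q, TopologicalSpace (P q)] [∀ q, IsTopologicalGroup (P q)] [∀ q, CompactSpace (P q)]
    [∀ q, TotallyDisconnectedSpace (P q)]
    (hP : ∀ q, ∀ U : OpenNormalSubgroup (P q), IsPGroup (q : ℕ) (P q ⧸ (U : Subgroup (P q))))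
    (htfg : ∀ q, ∃ (d : ℕ) (a : Fin d → P q), (Subgroup.closure (Set.range a)).topologicalClosure = ⊤)
    (H : Subgroup (∀ q, P q)) [H.FiniteIndex] : IsOpen (H : Set (∀ q, P q)) :=
  isOpen_of_finiteIndex_pi (fun q : Nat.Primes => (q : ℕ)) (fun q => q.2) (fun _ _ h => Subtype.ext h)
    hP htfg H

end PiProduct

end Literature.GroupTheory.ProP
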